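import Summits.ABC.StewartYu.MultiquadraticLiouvilleExt
import HarnessLib

/-!
# Cell abc-stewartyu, WP-Y (route M2 `PadicPrimesYuNinety`, infrastructure I4): the algebra of the
# half points of the `K = ℚ` twist engine at ALL odd primes — roots of unity confined to `±1, ±ι`,
# the `ι`-split of the class sums, the signed Kummer condition, separation and Liouville

`Summits/ABC/StewartYu/TwistHalfPointAlgebra.lean` — cell `abc-stewartyu` (HOME
`run/shared/lean/pub/abc-stewartyu/`, seat p3; theorems only, no definition, no named fact). Design memo:
HOME/p3/memo-03-odd-twist-engine.md §2 (II)–(IV) (evidence on items stmt-ABC-19249/19250); this file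
is its kernel-checked, SET-UP-FREE algebraic core.

Setting (memo §1–§2). `p` odd, `M = (p−1)/2`, `ζ ∈ ℤ_p` a primitive `(p−1)`-th root of unity,
`θⱼ = αⱼ ζ^{rⱼ}` the principal twists of the rational units `αⱼ`; in a field `L ⊇ ℚ_p` (e.g. `ℂ_p`)
fix `ξ` with `ξ² = ζ` and put `ι := ξ^M` (`ι² = −1`); the principal square roots `σⱼ = √θⱼ ∈ ℚ_p`
and the ALGEBRAIC square roots `ŝⱼ := σⱼ ξ^{−rⱼ}` (`ŝⱼ² = αⱼ ∈ ℚ`) are related by `σⱼ = ŝⱼ ξ^{rⱼ}`.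
On an exponent class `∑ rⱼ eⱼ = c + k·M` the value of a monomial at a half point is
`∏ σⱼ^{eⱼ} = ξ^{c} · ι^{k} · ∏ ŝⱼ^{eⱼ}` (`prod_twist_pow`, `pow_class_split`), `ι^k = (−1)^{⌊k/2⌋}·ι^{k mod 2}`
(`iota_pow_eq`), so a sum over the class splits as `ξ^c · (Σ₀ + ι·Σ₁)` with the SIGNS `(−1)^{⌊k/2⌋}`
absorbed into the rational weights (`sum_twist_split`) — `Σ₀`, `Σ₁` are then `Multiquad.evL ŝ C₀`,
`Multiquad.evL ŝ C₁` by the landed `SetupQ.sum_prod_root_pow_eq_evL` (any field). This file supplies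
the rest of memo §2 (III):

* `exists_glue` — a coefficient vector `C` over `k+1` roots with `CW77.lo C = C₀`, `CW77.hi C = C₁`, hence
  `evL (Fin.snoc ŝ ι) C = evL ŝ C₀ + ι · evL ŝ C₁` (`evL_snoc_glue`, from the landed `evL_succ`), with
  `∑|C| = ∑|C₀| + ∑|C₁|`, denominators and (non-)vanishing transported;
* `not_isSquare_prod_snoc_neg_one` — the SIGNED Kummer condition on `α` (no `∏_T αⱼ` and no `−∏_T αⱼ`
  is a square, `T ≠ ∅`; the hypothesis of the registered engine `EngineThreeModFour`) is exactly the
  plain `2`-Kummer condition for the extended family `Fin.snoc α (−1)` (root `ι`);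
* `eq_zero_of_evL_add_iota_mul_eq_zero` — SEPARATION: `evL ŝ C₀ + ι · evL ŝ C₁ = 0 ⇒ C₀ = 0 ∧ C₁ = 0`
  in ANY field of characteristic zero (the landed `Multiquad.evL_ne_zero` on the extended family) —
  this is the step where Yu 1990 needs (2.97) over `K(ξ^{G₁}) ∋ ζ₈` and hence `ζ₄ ∈ K` when
  `p ≡ 1 (mod 4)`; here only `[ℚ(ι, √α):ℚ] = 2^{k+1}` enters, true for distinct primes including `2`;
* `norm_evL_add_iota_mul_ge` — LIOUVILLE: in any ultrametric `L` with `‖z‖ ≤ 1` on `ℤ`, `‖n‖ ≥ 1/n`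
  (p3's I1 `MultiquadExt.norm_evL_ge_sharp_of_norm_int`; `ℂ_p` qualifies, `PadicComplexLiouville.lean`),
  `‖evL ŝ C₀ + ι · evL ŝ C₁‖ ≥ D/(4D²M(∏H(αⱼ))³)^{2^{k+1}}` unless `C₀ = C₁ = 0` (`H(−1) = 1`).

Everything is [folklore] algebra; nothing here is claimed to be in print. WHAT THIS IS NOT: not the
half step of any engine (that needs the engine's set-up for `σⱼ = psqrt θⱼ`, the class data and the
sizes `D, M`); this is its field-theoretic core, usable verbatim at `p ≡ 1` and `p ≡ 3 (mod 4)`.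
-/

noncomputable section

open Finset Literature.NumberTheory.Transcendental.CW77

namespace Summit.ABC.StewartYu

namespace TwistHalf

open Literature.NumberTheory.Transcendental Multiquad

/-! ### §1 Roots of unity: the twist factor of a monomial and the `ι`-split of a class sum -/

section RootsOfUnity

variable {L : Type*} [Field L]

/-- `∏ (ŝⱼ ξ^{rⱼ})^{eⱼ} = ξ^{∑ rⱼ eⱼ} · ∏ ŝⱼ^{eⱼ}`: the twist factor of a monomial at a half point
(`σⱼ = ŝⱼ ξ^{rⱼ}`). [folklore] -/
theorem prod_twist_pow {n : ℕ} (ŝ : Fin n → L) (ξ : L) (r e : Fin n → ℕ) :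
    ∏ i, (ŝ i * ξ ^ r i) ^ e i = ξ ^ (∑ i, r i * e i) * ∏ i, ŝ i ^ e i := by
  calc ∏ i, (ŝ i * ξ ^ r i) ^ e i = ∏ i, (ŝ i ^ e i * ξ ^ (r i * e i)) :=
        Finset.prod_congr rfl fun i _ => by rw [mul_pow, ← pow_mul]
    _ = (∏ i, ŝ i ^ e i) * ∏ i, ξ ^ (r i * e i) := Finset.prod_mul_distrib
    _ = ξ ^ (∑ i, r i * e i) * ∏ i, ŝ i ^ e i := by rw [Finset.prod_pow_eq_pow_sum, mul_comm]

/-- On an exponent class `∑ rⱼeⱼ = c + k·M`: `ξ^{c + kM} = ξ^c · ι^k` for `ι = ξ^M`. [folklore] -/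
theorem pow_class_split (ξ ι : L) {M c k : ℕ} (hι : ξ ^ M = ι) :
    ξ ^ (c + k * M) = ξ ^ c * ι ^ k := by
  rw [pow_add, ← hι, ← pow_mul, mul_comm k M]

/-- `ι^k = (−1)^{⌊k/2⌋}` for even `k`, `= (−1)^{⌊k/2⌋} · ι` for odd `k` (`ι² = −1`). [folklore] -/
theorem iota_pow_eq (ι : L) (hι : ι ^ 2 = -1) (k : ℕ) :
    ι ^ k = (-1) ^ (k / 2) * (if Even k then 1 else ι) := by
  rcases Nat.even_or_odd k with ⟨j, hj⟩ | ⟨j, hj⟩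
  · have hk : k = 2 * j := by omega
    rw [if_pos ⟨j, hj⟩, hk, pow_mul, hι, Nat.mul_div_cancel_left _ two_pos, mul_one]
  · have hne : ¬ Even k := by rw [Nat.not_even_iff_odd]; exact ⟨j, hj⟩
    rw [if_neg hne, hj, pow_succ, pow_mul, hι,
      show (2 * j + 1) / 2 = j by omega]

/-- **The `ι`-split of a class sum.** `∑_u a_u ι^{k_u} X_u = Σ₀ + ι·Σ₁` with
`Σ₀ = ∑_{k_u even} (−1)^{⌊k_u/2⌋} a_u X_u`, `Σ₁ = ∑_{k_u odd} (−1)^{⌊k_u/2⌋} a_u X_u`: only `±1` and `±ι`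
occur, and the signs go into the weights. [folklore] -/
theorem sum_twist_split {υ : Type*} (U : Finset υ) (a X : υ → L) (k : υ → ℕ) (ι : L)
    (hι : ι ^ 2 = -1) :
    ∑ u ∈ U, a u * ι ^ k u * X u =
      (∑ u ∈ U.filter (fun u => Even (k u)), ((-1) ^ (k u / 2) * a u) * X u) +
        ι * ∑ u ∈ U.filter (fun u => ¬ Even (k u)), ((-1) ^ (k u / 2) * a u) * X u := by
  classical
  rw [← Finset.sum_filter_add_sum_filter_not U (fun u => Even (k u)), Finset.mul_sum]
  congr 1
  · refine Finset.sum_congr rfl fun u hu => ?_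
    rw [iota_pow_eq ι hι, if_pos (Finset.mem_filter.mp hu).2]; ring
  · refine Finset.sum_congr rfl fun u hu => ?_
    rw [iota_pow_eq ι hι, if_neg (Finset.mem_filter.mp hu).2]; ring

/-- The full half-point identity on one class: if `∑ rⱼ eⱼ(u) = c + k_u·M` for every `u ∈ U`, then
`∑_u a_u ∏ⱼ (ŝⱼ ξ^{rⱼ})^{eⱼ(u)} = ξ^c · (Σ₀ + ι·Σ₁)` with `Σ_b = ∑_{k_u ≡ b} (−1)^{⌊k_u/2⌋} a_u ∏ ŝⱼ^{eⱼ(u)}`.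
[folklore] -/
theorem sum_prod_twist_eq {υ : Type*} {n : ℕ} (U : Finset υ) (a : υ → L) (e : υ → Fin n → ℕ)
    (ŝ : Fin n → L) (ξ ι : L) (r : Fin n → ℕ) {M c : ℕ} (k : υ → ℕ) (hι : ξ ^ M = ι)
    (hι2 : ι ^ 2 = -1) (hcls : ∀ u ∈ U, ∑ i, r i * e u i = c + k u * M) :
    ∑ u ∈ U, a u * ∏ i, (ŝ i * ξ ^ r i) ^ e u i =
      ξ ^ c * ((∑ u ∈ U.filter (fun u => Even (k u)), ((-1) ^ (k u / 2) * a u) * ∏ i, ŝ i ^ e u i) +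
        ι * ∑ u ∈ U.filter (fun u => ¬ Even (k u)), ((-1) ^ (k u / 2) * a u) * ∏ i, ŝ i ^ e u i) := by
  rw [← sum_twist_split _ _ _ _ ι hι2, Finset.mul_sum]
  refine Finset.sum_congr rfl fun u hu => ?_
  rw [prod_twist_pow, hcls u hu, pow_class_split ξ ι hι]
  ring

end RootsOfUnity

/-! ### §2 Gluing two coefficient vectors along the extra root `ι` -/

section Glue

variable {L : Type*} [Field L] [CharZero L] {k : ℕ}

/-- The pre-image of a set of indices of `Fin (k+1)` in `Fin k` under `castSucc`. [folklore] -/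
theorem filter_castSucc_mem_map (S : Finset (Fin k)) :
    (Finset.univ.filter fun j : Fin k => Fin.castSucc j ∈ S.map Fin.castSuccEmb) = S := by
  ext j
  simp only [Finset.mem_filter, Finset.mem_univ, true_and, Finset.mem_map, Fin.castSuccEmb_apply]
  constructor
  · rintro ⟨i, hi, h⟩
    rwa [← Fin.castSucc_injective _ h]
  · intro hj; exact ⟨j, hj, rfl⟩

/-- The same after inserting the last index. [folklore] -/
theorem filter_castSucc_mem_insert (S : Finset (Fin k)) :
    (Finset.univ.filter fun j : Fin k =>
      Fin.castSucc j ∈ insert (Fin.last k) (S.map Fin.castSuccEmb)) = S := by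
  ext j
  simp only [Finset.mem_filter, Finset.mem_univ, true_and, Finset.mem_insert, Finset.mem_map,
    Fin.castSuccEmb_apply]
  constructor
  · rintro (h | ⟨i, hi, h⟩)
    · exact absurd h (Fin.castSucc_lt_last j).ne
    · rwa [← Fin.castSucc_injective _ h]
  · intro hj; exact Or.inr ⟨j, hj, rfl⟩

/-- **Gluing.** Two coefficient vectors `C₀, C₁` over `k` roots are the `lo`/`hi` parts of one vector
`C` over `k+1` roots. [folklore] -/
theorem exists_glue (C₀ C₁ : Finset (Fin k) → ℚ) :
    ∃ C : Finset (Fin (k + 1)) → ℚ, CW77.lo C = C₀ ∧ CW77.hi C = C₁ := by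
  classical
  refine ⟨fun S => if Fin.last k ∈ S
      then C₁ (Finset.univ.filter fun j : Fin k => Fin.castSucc j ∈ S)
      else C₀ (Finset.univ.filter fun j : Fin k => Fin.castSucc j ∈ S), ?_, ?_⟩
  · funext S
    unfold CW77.lo
    simp only [if_neg (last_not_mem_map S)]
    rw [filter_castSucc_mem_map]
  · funext S
    unfold CW77.hi
    simp only [if_pos (Finset.mem_insert_self _ _)]
    rw [filter_castSucc_mem_insert]

/-- `CW77.lo 0 = 0`. [folklore] -/
theorem lo_zero : CW77.lo (0 : Finset (Fin (k + 1)) → ℚ) = 0 := by funext S; rfl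

/-- `CW77.hi 0 = 0`. [folklore] -/
theorem hi_zero : CW77.hi (0 : Finset (Fin (k + 1)) → ℚ) = 0 := by funext S; rfl

/-- A vector vanishes iff its `lo` and `hi` parts vanish. [folklore] -/
theorem eq_zero_iff_lo_hi (C : Finset (Fin (k + 1)) → ℚ) : C = 0 ↔ CW77.lo C = 0 ∧ CW77.hi C = 0 := by
  constructor
  · rintro rfl; exact ⟨lo_zero, hi_zero⟩
  · rintro ⟨h0, h1⟩
    by_contra hC
    rcases lo_hi_ne_zero hC with h | h
    · exact h h0
    · exact h h1

/-- Denominators glue: if `D·C₀, D·C₁ ∈ ℤ` then `D·C ∈ ℤ` for any `C` with these `lo`/`hi` parts.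
[folklore] -/
theorem den_of_lo_hi (C : Finset (Fin (k + 1)) → ℚ) {D : ℕ}
    (h0 : ∀ S, ∃ z : ℤ, (D : ℚ) * CW77.lo C S = z) (h1 : ∀ S, ∃ z : ℤ, (D : ℚ) * CW77.hi C S = z) :
    ∀ S, ∃ z : ℤ, (D : ℚ) * C S = z := by
  classical
  intro S
  by_cases hS : Fin.last k ∈ S
  · -- `S = insert last (S'.map castSucc)` with `S' = filter`
    set S' : Finset (Fin k) := Finset.univ.filter fun j : Fin k => Fin.castSucc j ∈ S with hS'
    have hSeq : S = insert (Fin.last k) (S'.map Fin.castSuccEmb) := by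
      ext j
      simp only [Finset.mem_insert, Finset.mem_map, hS', Finset.mem_filter, Finset.mem_univ,
        true_and, Fin.castSuccEmb_apply]
      constructor
      · intro hj
        by_cases hjl : j = Fin.last k
        · exact Or.inl hjl
        · right
          obtain ⟨i, rfl⟩ := Fin.exists_castSucc_eq.mpr hjl
          exact ⟨i, hj, rfl⟩
      · rintro (rfl | ⟨i, hi, rfl⟩)
        · exact hS
        · exact hi
    obtain ⟨z, hz⟩ := h1 S'
    refine ⟨z, ?_⟩
    rw [hSeq]; exact hz
  · set S' : Finset (Fin k) := Finset.univ.filter fun j : Fin k => Fin.castSucc j ∈ S with hS'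
    have hSeq : S = S'.map Fin.castSuccEmb := by
      ext j
      simp only [Finset.mem_map, hS', Finset.mem_filter, Finset.mem_univ, true_and,
        Fin.castSuccEmb_apply]
      constructor
      · intro hj
        have hjl : j ≠ Fin.last k := fun h => hS (h ▸ hj)
        obtain ⟨i, rfl⟩ := Fin.exists_castSucc_eq.mpr hjl
        exact ⟨i, hj, rfl⟩
      · rintro ⟨i, hi, rfl⟩; exact hi
    obtain ⟨z, hz⟩ := h0 S'
    refine ⟨z, ?_⟩
    rw [hSeq]; exact hz

omit [CharZero L] in
/-- **`evL (Fin.snoc ŝ ι) C = evL ŝ (CW77.lo C) + ι · evL ŝ (CW77.hi C)`** (the landed `evL_succ` for the family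
extended by `ι` as the LAST root). [folklore] -/
theorem evL_snoc_glue (ŝ : Fin k → L) (ι : L) (C : Finset (Fin (k + 1)) → ℚ) :
    evL (Fin.snoc ŝ ι : Fin (k + 1) → L) C = evL ŝ (CW77.lo C) + ι * evL ŝ (CW77.hi C) := by
  rw [evL_succ]
  have h1 : initL (Fin.snoc ŝ ι : Fin (k + 1) → L) = ŝ := by
    funext j; simp [initL]
  rw [h1, Fin.snoc_last]

omit [CharZero L] in
/-- The extended family squares to the extended generators `Fin.snoc α (−1)` when `ι² = −1`.
[folklore] -/
theorem snoc_sq (α : Fin k → ℚ) (ŝ : Fin k → L) (hs : ∀ j, ŝ j * ŝ j = (α j : L)) (ι : L)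
    (hι : ι * ι = -1) (j : Fin (k + 1)) :
    (Fin.snoc ŝ ι : Fin (k + 1) → L) j * (Fin.snoc ŝ ι : Fin (k + 1) → L) j =
      ((Fin.snoc α (-1) : Fin (k + 1) → ℚ) j : L) := by
  refine Fin.lastCases ?_ (fun i => ?_) j
  · simp only [Fin.snoc_last, hι]; push_cast; ring
  · simp only [Fin.snoc_castSucc, hs i]

end Glue

/-! ### §3 The signed Kummer condition = the `2`-Kummer condition with the root `ι` adjoined -/

section Kummer

variable {k : ℕ}

/-- **Signed Kummer ⇒ Kummer for `Fin.snoc α (−1)`.** If no product `∏_{j∈T} αⱼ` over a non-empty `T`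
and none of their negatives is a square in `ℚ`, then no product over a non-empty set of the extended
family `(α₀, …, α_{k−1}, −1)` is a square. [folklore] -/
theorem not_isSquare_prod_snoc_neg_one (α : Fin k → ℚ)
    (hind : ∀ T : Finset (Fin k), T.Nonempty →
      ¬ IsSquare (∏ j ∈ T, α j) ∧ ¬ IsSquare (-∏ j ∈ T, α j))
    (T' : Finset (Fin (k + 1))) (hT' : T'.Nonempty) :
    ¬ IsSquare (∏ j ∈ T', (Fin.snoc α (-1) : Fin (k + 1) → ℚ) j) := by
  classical
  set T : Finset (Fin k) := Finset.univ.filter fun i : Fin k => Fin.castSucc i ∈ T' with hT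
  -- split the product over `T'` into the `castSucc` part and the `last` part
  have hsplit : ∏ j ∈ T', (Fin.snoc α (-1) : Fin (k + 1) → ℚ) j =
      (∏ i ∈ T, α i) * (if Fin.last k ∈ T' then -1 else 1) := by
    have h1 : ∏ j ∈ T', (Fin.snoc α (-1) : Fin (k + 1) → ℚ) j =
        ∏ j, (if j ∈ T' then (Fin.snoc α (-1) : Fin (k + 1) → ℚ) j else 1) := by
      rw [← Finset.prod_filter]; congr 1; ext j; simp
    rw [h1, Fin.prod_univ_castSucc]
    congr 1
    · rw [hT, Finset.prod_filter]
      refine Finset.prod_congr rfl fun i _ => ?_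
      simp only [Fin.snoc_castSucc]
    · simp only [Fin.snoc_last]
  rw [hsplit]
  by_cases hlast : Fin.last k ∈ T'
  · rw [if_pos hlast, mul_neg_one]
    by_cases hTne : T.Nonempty
    · exact (hind T hTne).2
    · rw [Finset.not_nonempty_iff_eq_empty] at hTne
      rw [hTne, Finset.prod_empty]
      -- `−1` is not a square in `ℚ` (also the tree's `…curve480a1.not_isSquare_neg_one`)
      rintro ⟨r, hr⟩
      have : (0 : ℚ) ≤ r * r := mul_self_nonneg r
      linarith
  · rw [if_neg hlast, mul_one]
    have hTne : T.Nonempty := by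
      obtain ⟨j, hj⟩ := hT'
      have hjl : j ≠ Fin.last k := fun h => hlast (h ▸ hj)
      obtain ⟨i, rfl⟩ := Fin.exists_castSucc_eq.mpr hjl
      exact ⟨i, by rw [hT]; simpa using hj⟩
    exact (hind T hTne).1

end Kummer

/-! ### §4 Separation and Liouville for `evL ŝ C₀ + ι · evL ŝ C₁` -/

section Separation

variable {L : Type*} [Field L] [CharZero L] {k : ℕ}

/-- **Separation.** Under the signed Kummer condition on `α`, with `ŝⱼ² = αⱼ` and `ι² = −1` in any
field of characteristic zero: `evL ŝ C₀ + ι · evL ŝ C₁ = 0` forces `C₀ = 0` and `C₁ = 0` — so at a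
half point of the twist engine ALL class sums (even-`k` and odd-`k` parts, memo §2 (III)) vanish.
[folklore] -/
theorem eq_zero_of_evL_add_iota_mul_eq_zero (α : Fin k → ℚ)
    (hind : ∀ T : Finset (Fin k), T.Nonempty →
      ¬ IsSquare (∏ j ∈ T, α j) ∧ ¬ IsSquare (-∏ j ∈ T, α j))
    (ŝ : Fin k → L) (hs : ∀ j, ŝ j * ŝ j = (α j : L)) (ι : L) (hι : ι * ι = -1)
    (C₀ C₁ : Finset (Fin k) → ℚ) (h : evL ŝ C₀ + ι * evL ŝ C₁ = 0) :
    C₀ = 0 ∧ C₁ = 0 := by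
  obtain ⟨C, hlo, hhi⟩ := exists_glue C₀ C₁
  have hC : evL (Fin.snoc ŝ ι : Fin (k + 1) → L) C = 0 := by
    rw [evL_snoc_glue, hlo, hhi, h]
  have hC0 : C = 0 := by
    by_contra hne
    exact evL_ne_zero (Fin.snoc α (-1)) (not_isSquare_prod_snoc_neg_one α hind)
      (Fin.snoc ŝ ι) (snoc_sq α ŝ hs ι hι) hne hC
  rw [← hlo, ← hhi, hC0]
  exact ⟨lo_zero, hi_zero⟩

end Separation

section Liouville

variable {L : Type*} [NormedField L] [IsUltrametricDist L] [CharZero L] {k : ℕ}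

/-- `heightProd (Fin.snoc α (−1)) = heightProd α` (`H(−1) = max(|−1|, 1) = 1`). [folklore] -/
theorem heightProd_snoc_neg_one (α : Fin k → ℚ) :
    heightProd (Fin.snoc α (-1) : Fin (k + 1) → ℚ) = heightProd α := by
  unfold heightProd
  rw [Fin.prod_univ_castSucc]
  simp only [Fin.snoc_castSucc, Fin.snoc_last]
  have : hgt (-1) = 1 := by unfold hgt; norm_num
  rw [this, mul_one]

/-- **Liouville for the `ι`-split value.** In an ultrametric field `L` of characteristic zero with
`‖z‖ ≤ 1` on `ℤ` and `‖n‖ ≥ 1/n` (e.g. `ℂ_p`): under the signed Kummer condition on `α`, with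
`ŝⱼ² = αⱼ`, `‖ŝⱼ‖ ≤ 1`, `ι² = −1`, and coefficient vectors `C₀, C₁` not both zero with `D·C_b ∈ ℤ`,
`∑|C₀| + ∑|C₁| ≤ M` (`D, M ≥ 1`):
`‖evL ŝ C₀ + ι · evL ŝ C₁‖ ≥ D / (4 D² M (∏ H(αⱼ))³)^{2^{k+1}}` (p3's I1 on the extended family; the
root `ι` costs one doubling of the exponent and nothing in the heights). [folklore] -/
theorem norm_evL_add_iota_mul_ge (hZ : ∀ z : ℤ, ‖(z : L)‖ ≤ 1)
    (hN : ∀ n : ℕ, n ≠ 0 → (n : ℝ)⁻¹ ≤ ‖(n : L)‖) (α : Fin k → ℚ)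
    (hind : ∀ T : Finset (Fin k), T.Nonempty →
      ¬ IsSquare (∏ j ∈ T, α j) ∧ ¬ IsSquare (-∏ j ∈ T, α j))
    (ŝ : Fin k → L) (hs : ∀ j, ŝ j * ŝ j = (α j : L)) (hs1 : ∀ j, ‖ŝ j‖ ≤ 1)
    (ι : L) (hι : ι * ι = -1)
    (C₀ C₁ : Finset (Fin k) → ℚ) (hne : ¬ (C₀ = 0 ∧ C₁ = 0)) (D : ℕ) (hD : 1 ≤ D)
    (hden₀ : ∀ S, ∃ z : ℤ, (D : ℚ) * C₀ S = z) (hden₁ : ∀ S, ∃ z : ℤ, (D : ℚ) * C₁ S = z)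
    (M : ℝ) (hM : 1 ≤ M) (hcM : ∑ S, |(C₀ S : ℝ)| + ∑ S, |(C₁ S : ℝ)| ≤ M) :
    (D : ℝ) / (4 * (D : ℝ) ^ 2 * M * heightProd α ^ 3) ^ (2 ^ (k + 1)) ≤
      ‖evL ŝ C₀ + ι * evL ŝ C₁‖ := by
  obtain ⟨C, hlo, hhi⟩ := exists_glue C₀ C₁
  have hι1 : ‖ι‖ ≤ 1 := by
    have h2 : ‖ι‖ * ‖ι‖ = 1 := by rw [← norm_mul, hι, norm_neg, norm_one]
    nlinarith [norm_nonneg ι]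
  have hs1' : ∀ j, ‖(Fin.snoc ŝ ι : Fin (k + 1) → L) j‖ ≤ 1 := fun j => by
    refine Fin.lastCases ?_ (fun i => ?_) j
    · simpa using hι1
    · simpa using hs1 i
  have hC : C ≠ 0 := by
    intro h0
    apply hne
    rw [← hlo, ← hhi, h0]
    exact ⟨lo_zero, hi_zero⟩
  have hden : ∀ S, ∃ z : ℤ, (D : ℚ) * C S = z :=
    den_of_lo_hi C (by rw [hlo]; exact hden₀) (by rw [hhi]; exact hden₁)
  have hcM' : ∑ S, |(C S : ℝ)| ≤ M := by rw [sum_abs_succ, hlo, hhi]; exact hcM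
  have key := MultiquadExt.norm_evL_ge_sharp_of_norm_int hZ hN (k + 1) (Fin.snoc α (-1))
    (not_isSquare_prod_snoc_neg_one α hind) (Fin.snoc ŝ ι) (snoc_sq α ŝ hs ι hι) hs1' C hC D hD
    hden M hM hcM'
  rw [heightProd_snoc_neg_one, evL_snoc_glue, hlo, hhi] at key
  exact key

end Liouville

end TwistHalf

end Summit.ABC.StewartYu

end
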